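import Mathlib
import Summits.NavierStokesRegularity.NavierStokesRegularity.Theorems.FilamentSkeletonRssClause13RRateColumnBall

/-!
# Clause 13-R: the rate column under the CURVATURE clause — Lipschitz bound, frozen direction on a window, and the affine structure of the
# column pairing density near the waist (line `rate_bordered_split` of crux `Clause13RNearStraightL`, stmt-NavierStokesRegularity-23612, STUB R)

Route `FilamentSkeletonRss`, Variant A1R.  STUB R's mechanism pairs the bordered defect with a weight `φ(τ)·b̂` on a window (memo
`CENSUS-23610-side-23612-g16.md` (m5); this hand's DIAG memo `DIAG-23612-rate-row-leafhand3-g0.md` §2, item 5 of its repair census).  The column side of that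
pairing needs the rate column `R(τ) = e₃ × X τ − ⟪e₃ × X τ, X′τ⟫X′τ` to be (i) Lipschitz and (ii) affine to second order near the waist, which the
CURVATURE clause 3 (`‖X″‖√Γ ≤ K`) delivers — sharper than the global tangent-oscillation tolerance `R_b` used in `…Clause13RRateColumnBall`:

* `norm_deriv_sub_le_of_curvature` — `‖X′τ − X′σ‖ ≤ (K/√Γ)|τ − σ|`; `norm_sub_chord_le_of_curvature` — `‖X τ − X c − (τ−c)•X′c‖ ≤ (K/√Γ)|τ−c|²`;
* `norm_rateColumn_sub_le` — **column Lipschitz bound** `‖R τ − R σ‖ ≤ |τ − σ|·(1 + 2(K/√Γ)‖X τ‖)`;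
* `inner_rateColumn_ge_frozen` — **frozen direction on a window**: `⟪R τ, R τ₀⟫ ≥ ‖R τ₀‖(‖R τ₀‖ − |τ − τ₀|(1 + 2(K/√Γ)‖X τ‖))` (with the File-A witness
  `‖R τ₀‖ ≥ √Γ` this is the far-window column floor);
* `inner_proj_self_eq_norm_sq`, `inner_proj_tangent_eq_zero` — projection identities;
* `inner_rateColumn_waist_affine` — **near-waist affine structure**: with `P₀ = R c` (the waist arm vector, `‖P₀‖ = m₀`),
  `|⟪R τ, P₀⟫ − ‖P₀‖² − (τ − c)⟪e₃ × X′c, P₀⟫| ≤ ‖P₀‖·(K/√Γ)|τ−c|·(|τ−c| + 2‖X τ‖)` — so an EVEN weight about `c` pairs the column to `m₀²∫φ` up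
  to a curvature error, the linear term dropping out.

Hand `leafhand-ns-filamentskeletonrs-3-g0` (LAND-ONLY); `--supports stmt-NavierStokesRegularity-23612 --as helper`.  HONEST FRAMING: elementary geometry of a
HYPOTHETICAL filament skeleton on the NEGATIVE side of a MODEL blow-up route; nothing here bears on Navier–Stokes regularity or blow-up; STUB R is NOT
proved here.
-/

noncomputable section

open Real Set Literature.Analysis.FluidPDE
open scoped RealInnerProductSpace InnerProductSpace
open Summit.NavierStokesRegularity.NavierStokesRegularity.Theorems.MatchedKernel
  (norm_sub_inner_smul_le norm_cross_single_two_le)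
open Summit.NavierStokesRegularity.NavierStokesRegularity.Theorems.Clause13RRateRow
  (norm_sub_waist_le norm_proj_sub_proj_le proj_add cross_single_two_add)

namespace Summit.NavierStokesRegularity.NavierStokesRegularity.Theorems.Clause13RRateColumnPairing
set_option linter.dupNamespace false

/-! ## §1 Curvature clause ⇒ tangent Lipschitz and second-order chord -/

/-- **Tangent Lipschitz bound from the curvature clause** `‖X″ σ‖·√Γ ≤ K` (`Γ > 0`): `‖X′τ − X′σ‖ ≤ (K/√Γ)|τ − σ|`. [folklore] -/
theorem norm_deriv_sub_le_of_curvature {X : ℝ → EuclideanSpace ℝ (Fin 3)} {K Γ : ℝ} (hX : ContDiff ℝ 2 X) (hΓ : 0 < Γ)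
    (hcurv : ∀ σ, ‖iteratedDeriv 2 X σ‖ * Real.sqrt Γ ≤ K) (τ σ : ℝ) :
    ‖deriv X τ - deriv X σ‖ ≤ K / Real.sqrt Γ * |τ - σ| := by
  have hsq : 0 < Real.sqrt Γ := Real.sqrt_pos.2 hΓ
  have hTd : Differentiable ℝ (deriv X) := hX.differentiable_deriv_two
  have h2 : iteratedDeriv 2 X = deriv (deriv X) := by rw [iteratedDeriv_succ, iteratedDeriv_one]
  have hb : ∀ s ∈ (Set.univ : Set ℝ), ‖deriv (deriv X) s‖ ≤ K / Real.sqrt Γ := fun s _ => by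
    rw [← h2, le_div_iff₀ hsq]; exact hcurv s
  have h := Convex.norm_image_sub_le_of_norm_deriv_le (fun s _ => hTd s) hb convex_univ (Set.mem_univ σ) (Set.mem_univ τ)
  rwa [Real.norm_eq_abs] at h

/-- **Second-order chord deviation from the curvature clause**: `‖X τ − X c − (τ−c)•X′c‖ ≤ (K/√Γ)·|τ − c|²`. [folklore] -/
theorem norm_sub_chord_le_of_curvature {X : ℝ → EuclideanSpace ℝ (Fin 3)} {K Γ : ℝ} (hX : ContDiff ℝ 2 X) (hΓ : 0 < Γ)
    (hcurv : ∀ σ, ‖iteratedDeriv 2 X σ‖ * Real.sqrt Γ ≤ K) (c τ : ℝ) :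
    ‖X τ - X c - (τ - c) • deriv X c‖ ≤ K / Real.sqrt Γ * |τ - c| ^ 2 := by
  have hXd : Differentiable ℝ X := hX.differentiable (by norm_num)
  have hF : ∀ σ ∈ Set.uIcc c τ,
      HasDerivWithinAt (fun σ => X σ - σ • deriv X c) (deriv X σ - deriv X c) (Set.uIcc c τ) σ := by
    intro σ _
    have h1 : HasDerivAt (fun σ : ℝ => σ • deriv X c) ((1:ℝ) • deriv X c) σ := (hasDerivAt_id σ).smul_const _
    rw [one_smul] at h1
    exact ((hXd σ).hasDerivAt.sub h1).hasDerivWithinAt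
  have hB : ∀ σ ∈ Set.uIcc c τ, ‖deriv X σ - deriv X c‖ ≤ K / Real.sqrt Γ * |τ - c| := by
    intro σ hσ
    have h := norm_deriv_sub_le_of_curvature hX hΓ hcurv σ c
    have hle : |σ - c| ≤ |τ - c| := Set.abs_sub_left_of_mem_uIcc hσ
    have hK : 0 ≤ K / Real.sqrt Γ := by
      have := le_trans (mul_nonneg (norm_nonneg _) (Real.sqrt_nonneg Γ)) (hcurv c)
      exact div_nonneg this (Real.sqrt_nonneg _)
    exact h.trans (mul_le_mul_of_nonneg_left hle hK)
  have h := Convex.norm_image_sub_le_of_norm_hasDerivWithin_le hF hB (convex_uIcc c τ) Set.left_mem_uIcc Set.right_mem_uIcc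
  have heq : (X τ - τ • deriv X c) - (X c - c • deriv X c) = X τ - X c - (τ - c) • deriv X c := by
    rw [sub_smul]; abel
  rw [heq, Real.norm_eq_abs] at h
  calc ‖X τ - X c - (τ - c) • deriv X c‖ ≤ K / Real.sqrt Γ * |τ - c| * |τ - c| := h
    _ = K / Real.sqrt Γ * |τ - c| ^ 2 := by ring

/-! ## §2 The column is Lipschitz; frozen direction on a window -/

/-- The cross product with `e₃` distributes over subtraction. [folklore] -/
theorem cross_single_two_sub (a b : EuclideanSpace ℝ (Fin 3)) :
    cross (EuclideanSpace.single 2 (1:ℝ)) (a - b) = cross (EuclideanSpace.single 2 (1:ℝ)) a - cross (EuclideanSpace.single 2 (1:ℝ)) b := by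
  rw [← crossCLM_apply, map_sub, crossCLM_apply, crossCLM_apply]

/-- The cross product with `e₃` commutes with scalars. [folklore] -/
theorem cross_single_two_smul (r : ℝ) (a : EuclideanSpace ℝ (Fin 3)) :
    cross (EuclideanSpace.single 2 (1:ℝ)) (r • a) = r • cross (EuclideanSpace.single 2 (1:ℝ)) a := by
  rw [← crossCLM_apply, map_smul, crossCLM_apply]

/-- The normal projection distributes over subtraction. [folklore] -/
theorem proj_sub (a b t : EuclideanSpace ℝ (Fin 3)) :
    (a - b) - ⟪a - b, t⟫ • t = (a - ⟪a, t⟫ • t) - (b - ⟪b, t⟫ • t) := by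
  rw [inner_sub_left, sub_smul]; abel

/-- **COLUMN LIPSCHITZ BOUND** (unit speed + curvature clause): `‖R τ − R σ‖ ≤ |τ − σ|·(1 + 2(K/√Γ)‖X τ‖)`. [folklore] -/
theorem norm_rateColumn_sub_le {X : ℝ → EuclideanSpace ℝ (Fin 3)} {K Γ : ℝ} (hX : ContDiff ℝ 2 X) (hΓ : 0 < Γ)
    (hunit : ∀ σ, ‖deriv X σ‖ = 1) (hcurv : ∀ σ, ‖iteratedDeriv 2 X σ‖ * Real.sqrt Γ ≤ K) (τ σ : ℝ) :
    ‖(cross (EuclideanSpace.single 2 (1:ℝ)) (X τ) - ⟪cross (EuclideanSpace.single 2 (1:ℝ)) (X τ), deriv X τ⟫ • deriv X τ)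
      - (cross (EuclideanSpace.single 2 (1:ℝ)) (X σ) - ⟪cross (EuclideanSpace.single 2 (1:ℝ)) (X σ), deriv X σ⟫ • deriv X σ)‖
      ≤ |τ - σ| * (1 + 2 * (K / Real.sqrt Γ) * ‖X τ‖) := by
  have hXd : Differentiable ℝ X := hX.differentiable (by norm_num)
  set e₃ : EuclideanSpace ℝ (Fin 3) := EuclideanSpace.single 2 (1:ℝ) with he₃
  set v := cross e₃ (X τ) with hv
  set n := deriv X τ with hn
  set m := deriv X σ with hm
  -- split: [P_n v − P_m v] + P_m (e₃ × (X τ − X σ))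
  have hsplit : (v - ⟪v, n⟫ • n) - (cross e₃ (X σ) - ⟪cross e₃ (X σ), m⟫ • m)
      = ((v - ⟪v, n⟫ • n) - (v - ⟪v, m⟫ • m)) + (cross e₃ (X τ - X σ) - ⟪cross e₃ (X τ - X σ), m⟫ • m) := by
    rw [cross_single_two_sub, proj_sub]; abel
  rw [hsplit]
  have h1 : ‖(v - ⟪v, n⟫ • n) - (v - ⟪v, m⟫ • m)‖ ≤ 2 * (K / Real.sqrt Γ * |τ - σ|) * ‖X τ‖ := by
    have h := norm_proj_sub_proj_le v m n (hunit σ) (hunit τ)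
    have hnm : ‖n - m‖ ≤ K / Real.sqrt Γ * |τ - σ| := norm_deriv_sub_le_of_curvature hX hΓ hcurv τ σ
    have hvX : ‖v‖ ≤ ‖X τ‖ := norm_cross_single_two_le _
    calc ‖(v - ⟪v, n⟫ • n) - (v - ⟪v, m⟫ • m)‖ ≤ 2 * ‖n - m‖ * ‖v‖ := h
      _ ≤ 2 * (K / Real.sqrt Γ * |τ - σ|) * ‖X τ‖ := by
          have := mul_le_mul hnm hvX (norm_nonneg _) (le_trans (norm_nonneg _) hnm)
          linarith
  have h2 : ‖cross e₃ (X τ - X σ) - ⟪cross e₃ (X τ - X σ), m⟫ • m‖ ≤ |τ - σ| :=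
    le_trans (norm_sub_inner_smul_le _ m (hunit σ)) (le_trans (norm_cross_single_two_le _) (norm_sub_waist_le hXd hunit σ τ))
  calc ‖((v - ⟪v, n⟫ • n) - (v - ⟪v, m⟫ • m)) + (cross e₃ (X τ - X σ) - ⟪cross e₃ (X τ - X σ), m⟫ • m)‖
      ≤ ‖(v - ⟪v, n⟫ • n) - (v - ⟪v, m⟫ • m)‖ + ‖cross e₃ (X τ - X σ) - ⟪cross e₃ (X τ - X σ), m⟫ • m‖ := norm_add_le _ _
    _ ≤ 2 * (K / Real.sqrt Γ * |τ - σ|) * ‖X τ‖ + |τ - σ| := add_le_add h1 h2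
    _ = |τ - σ| * (1 + 2 * (K / Real.sqrt Γ) * ‖X τ‖) := by ring

/-- **FROZEN DIRECTION ON A WINDOW**: `⟪R τ, R τ₀⟫ ≥ ‖R τ₀‖·(‖R τ₀‖ − |τ − τ₀|(1 + 2(K/√Γ)‖X τ‖))`.  With the in-ball witness of
`…Clause13RRateColumnBall.exists_inBall_rateColumn_ge` (`‖R τ₀‖ ≥ √Γ`) this is the far-window column floor of the pairing. [folklore] -/
theorem inner_rateColumn_ge_frozen {X : ℝ → EuclideanSpace ℝ (Fin 3)} {K Γ : ℝ} (hX : ContDiff ℝ 2 X) (hΓ : 0 < Γ)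
    (hunit : ∀ σ, ‖deriv X σ‖ = 1) (hcurv : ∀ σ, ‖iteratedDeriv 2 X σ‖ * Real.sqrt Γ ≤ K) (τ τ₀ : ℝ) :
    ‖cross (EuclideanSpace.single 2 (1:ℝ)) (X τ₀) - ⟪cross (EuclideanSpace.single 2 (1:ℝ)) (X τ₀), deriv X τ₀⟫ • deriv X τ₀‖ *
        (‖cross (EuclideanSpace.single 2 (1:ℝ)) (X τ₀) - ⟪cross (EuclideanSpace.single 2 (1:ℝ)) (X τ₀), deriv X τ₀⟫ • deriv X τ₀‖
          - |τ - τ₀| * (1 + 2 * (K / Real.sqrt Γ) * ‖X τ‖))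
      ≤ ⟪cross (EuclideanSpace.single 2 (1:ℝ)) (X τ) - ⟪cross (EuclideanSpace.single 2 (1:ℝ)) (X τ), deriv X τ⟫ • deriv X τ,
         cross (EuclideanSpace.single 2 (1:ℝ)) (X τ₀) - ⟪cross (EuclideanSpace.single 2 (1:ℝ)) (X τ₀), deriv X τ₀⟫ • deriv X τ₀⟫ := by
  set Rτ := cross (EuclideanSpace.single 2 (1:ℝ)) (X τ) - ⟪cross (EuclideanSpace.single 2 (1:ℝ)) (X τ), deriv X τ⟫ • deriv X τ with hRτ
  set R₀ := cross (EuclideanSpace.single 2 (1:ℝ)) (X τ₀) - ⟪cross (EuclideanSpace.single 2 (1:ℝ)) (X τ₀), deriv X τ₀⟫ • deriv X τ₀ with hR₀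
  have hL : ‖Rτ - R₀‖ ≤ |τ - τ₀| * (1 + 2 * (K / Real.sqrt Γ) * ‖X τ‖) := norm_rateColumn_sub_le hX hΓ hunit hcurv τ τ₀
  clear_value Rτ R₀
  -- ⟪Rτ, R₀⟫ = ‖R₀‖² + ⟪Rτ − R₀, R₀⟫ ≥ ‖R₀‖² − ‖Rτ − R₀‖‖R₀‖
  have hdec : ⟪Rτ, R₀⟫ = ‖R₀‖ ^ 2 + ⟪Rτ - R₀, R₀⟫ := by
    rw [inner_sub_left, real_inner_self_eq_norm_sq]; ring
  have hcs : |⟪Rτ - R₀, R₀⟫| ≤ ‖Rτ - R₀‖ * ‖R₀‖ := abs_real_inner_le_norm _ _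
  have hR0 : 0 ≤ ‖R₀‖ := norm_nonneg _
  rw [hdec]
  nlinarith [abs_le.1 hcs |>.1, mul_le_mul_of_nonneg_right hL hR0]

/-! ## §3 Near the waist: the column pairing density is affine up to a curvature error -/

/-- `⟪w, P_t w⟫ = ‖P_t w‖²` for a unit `t`. [folklore] -/
theorem inner_proj_self_eq_norm_sq (w t : EuclideanSpace ℝ (Fin 3)) (ht : ‖t‖ = 1) :
    ⟪w, w - ⟪w, t⟫ • t⟫ = ‖w - ⟪w, t⟫ • t‖ ^ 2 := by
  rw [inner_sub_right, inner_smul_right, real_inner_self_eq_norm_sq, @norm_sub_sq_real, norm_smul, Real.norm_eq_abs, ht, mul_one,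
    sq_abs, inner_smul_right]
  ring

/-- `⟪P_t w, t⟫ = 0` for a unit `t`. [folklore] -/
theorem inner_proj_tangent_eq_zero (w t : EuclideanSpace ℝ (Fin 3)) (ht : ‖t‖ = 1) : ⟪w - ⟪w, t⟫ • t, t⟫ = 0 := by
  rw [inner_sub_left, inner_smul_left, real_inner_self_eq_norm_sq, ht]
  simp

/-- **NEAR-WAIST AFFINE STRUCTURE OF THE COLUMN PAIRING DENSITY.**  With `P₀ := R c = e₃ × X c − ⟪e₃ × X c, X′c⟫X′c` (the waist-arm vector):
`|⟪R τ, P₀⟫ − ‖P₀‖² − (τ − c)·⟪e₃ × X′c, P₀⟫| ≤ ‖P₀‖·(K/√Γ)·|τ − c|·(|τ − c| + 2‖X τ‖)`.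
Ingredients: `X τ = X c + (τ−c)X′c + E` with `‖E‖ ≤ (K/√Γ)|τ−c|²`; moving the projection from `X′τ` to `X′c` costs `2(K/√Γ)|τ−c|·‖X τ‖`;
`⟪e₃ × X c, P₀⟫ = ‖P₀‖²` and `P₀ ⊥ X′c`. [folklore] -/
theorem inner_rateColumn_waist_affine {X : ℝ → EuclideanSpace ℝ (Fin 3)} {K Γ : ℝ} (hX : ContDiff ℝ 2 X) (hΓ : 0 < Γ)
    (hunit : ∀ σ, ‖deriv X σ‖ = 1) (hcurv : ∀ σ, ‖iteratedDeriv 2 X σ‖ * Real.sqrt Γ ≤ K) (c τ : ℝ) :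
    |⟪cross (EuclideanSpace.single 2 (1:ℝ)) (X τ) - ⟪cross (EuclideanSpace.single 2 (1:ℝ)) (X τ), deriv X τ⟫ • deriv X τ,
        cross (EuclideanSpace.single 2 (1:ℝ)) (X c) - ⟪cross (EuclideanSpace.single 2 (1:ℝ)) (X c), deriv X c⟫ • deriv X c⟫
      - ‖cross (EuclideanSpace.single 2 (1:ℝ)) (X c) - ⟪cross (EuclideanSpace.single 2 (1:ℝ)) (X c), deriv X c⟫ • deriv X c‖ ^ 2
      - (τ - c) * ⟪cross (EuclideanSpace.single 2 (1:ℝ)) (deriv X c),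
          cross (EuclideanSpace.single 2 (1:ℝ)) (X c) - ⟪cross (EuclideanSpace.single 2 (1:ℝ)) (X c), deriv X c⟫ • deriv X c⟫|
      ≤ ‖cross (EuclideanSpace.single 2 (1:ℝ)) (X c) - ⟪cross (EuclideanSpace.single 2 (1:ℝ)) (X c), deriv X c⟫ • deriv X c‖
        * (K / Real.sqrt Γ) * |τ - c| * (|τ - c| + 2 * ‖X τ‖) := by
  set e₃ : EuclideanSpace ℝ (Fin 3) := EuclideanSpace.single 2 (1:ℝ) with he₃
  set t := deriv X c with ht_def
  set n := deriv X τ with hn_def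
  set x₀ := X c with hx₀
  set P₀ := cross e₃ x₀ - ⟪cross e₃ x₀, t⟫ • t with hP₀
  set v := cross e₃ (X τ) with hv
  set E := X τ - x₀ - (τ - c) • t with hE_def
  have ht : ‖t‖ = 1 := hunit c
  have hn : ‖n‖ = 1 := hunit τ
  have hK : 0 ≤ K / Real.sqrt Γ := by
    have := le_trans (mul_nonneg (norm_nonneg _) (Real.sqrt_nonneg Γ)) (hcurv c)
    exact div_nonneg this (Real.sqrt_nonneg _)
  have hE : ‖E‖ ≤ K / Real.sqrt Γ * |τ - c| ^ 2 := norm_sub_chord_le_of_curvature hX hΓ hcurv c τ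
  have hnt : ‖n - t‖ ≤ K / Real.sqrt Γ * |τ - c| := norm_deriv_sub_le_of_curvature hX hΓ hcurv τ c
  have hperp : ⟪P₀, t⟫ = 0 := inner_proj_tangent_eq_zero (cross e₃ x₀) t ht
  have hself : ⟪cross e₃ x₀, P₀⟫ = ‖P₀‖ ^ 2 := inner_proj_self_eq_norm_sq (cross e₃ x₀) t ht
  have hXτ : X τ = (x₀ + (τ - c) • t) + E := by rw [hE_def]; abel
  clear_value E P₀ n t x₀ v
  -- (1) move the projection: ⟪P_n v, P₀⟫ = ⟪P_n v − P_t v, P₀⟫ + ⟪P_t v, P₀⟫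
  have hmove : |⟪(v - ⟪v, n⟫ • n) - (v - ⟪v, t⟫ • t), P₀⟫| ≤ 2 * (K / Real.sqrt Γ * |τ - c|) * ‖X τ‖ * ‖P₀‖ := by
    have h := norm_proj_sub_proj_le v t n ht hn
    have hvX : ‖v‖ ≤ ‖X τ‖ := by rw [hv]; exact norm_cross_single_two_le _
    calc |⟪(v - ⟪v, n⟫ • n) - (v - ⟪v, t⟫ • t), P₀⟫| ≤ ‖(v - ⟪v, n⟫ • n) - (v - ⟪v, t⟫ • t)‖ * ‖P₀‖ := abs_real_inner_le_norm _ _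
      _ ≤ (2 * ‖n - t‖ * ‖v‖) * ‖P₀‖ := mul_le_mul_of_nonneg_right h (norm_nonneg _)
      _ ≤ 2 * (K / Real.sqrt Γ * |τ - c|) * ‖X τ‖ * ‖P₀‖ := by
          have := mul_le_mul hnt hvX (norm_nonneg _) (le_trans (norm_nonneg _) hnt)
          have hP := norm_nonneg P₀
          nlinarith
  have h1 : ⟪v - ⟪v, n⟫ • n, P₀⟫ = ⟪(v - ⟪v, n⟫ • n) - (v - ⟪v, t⟫ • t), P₀⟫ + ⟪v - ⟪v, t⟫ • t, P₀⟫ := by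
    rw [← inner_add_left, sub_add_cancel]
  -- (2) ⟪P_t v, P₀⟫ = ⟪v, P₀⟫ (P₀ ⊥ t)
  have hPt : ⟪v - ⟪v, t⟫ • t, P₀⟫ = ⟪v, P₀⟫ := by
    rw [inner_sub_left, inner_smul_left, real_inner_comm P₀ t, hperp]; simp
  -- (3) expand v = e₃ × (x₀ + (τ−c)t + E)
  have hvexp : v = cross e₃ x₀ + (τ - c) • cross e₃ t + cross e₃ E := by
    rw [hv, hXτ, cross_single_two_add, cross_single_two_add, cross_single_two_smul]
  have hv3 : ⟪v, P₀⟫ = ‖P₀‖ ^ 2 + (τ - c) * ⟪cross e₃ t, P₀⟫ + ⟪cross e₃ E, P₀⟫ := by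
    rw [hvexp, inner_add_left, inner_add_left, inner_smul_left, hself]; simp
  have herrE : |⟪cross e₃ E, P₀⟫| ≤ K / Real.sqrt Γ * |τ - c| ^ 2 * ‖P₀‖ := by
    calc |⟪cross e₃ E, P₀⟫| ≤ ‖cross e₃ E‖ * ‖P₀‖ := abs_real_inner_le_norm _ _
      _ ≤ ‖E‖ * ‖P₀‖ := mul_le_mul_of_nonneg_right (norm_cross_single_two_le E) (norm_nonneg _)
      _ ≤ K / Real.sqrt Γ * |τ - c| ^ 2 * ‖P₀‖ := mul_le_mul_of_nonneg_right hE (norm_nonneg _)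
  -- assemble
  have hmain : ⟪v - ⟪v, n⟫ • n, P₀⟫ - ‖P₀‖ ^ 2 - (τ - c) * ⟪cross e₃ t, P₀⟫
      = ⟪(v - ⟪v, n⟫ • n) - (v - ⟪v, t⟫ • t), P₀⟫ + ⟪cross e₃ E, P₀⟫ := by
    linarith [h1, hPt, hv3]
  rw [hmain]
  have hP := norm_nonneg P₀
  have hτ := abs_nonneg (τ - c)
  calc |⟪(v - ⟪v, n⟫ • n) - (v - ⟪v, t⟫ • t), P₀⟫ + ⟪cross e₃ E, P₀⟫|
      ≤ |⟪(v - ⟪v, n⟫ • n) - (v - ⟪v, t⟫ • t), P₀⟫| + |⟪cross e₃ E, P₀⟫| := abs_add_le _ _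
    _ ≤ 2 * (K / Real.sqrt Γ * |τ - c|) * ‖X τ‖ * ‖P₀‖ + K / Real.sqrt Γ * |τ - c| ^ 2 * ‖P₀‖ := add_le_add hmove herrE
    _ = ‖P₀‖ * (K / Real.sqrt Γ) * |τ - c| * (|τ - c| + 2 * ‖X τ‖) := by ring

end Summit.NavierStokesRegularity.NavierStokesRegularity.Theorems.Clause13RRateColumnPairing

end
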